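import Summits.Ventures.PercRepro.MSTightProduct
import Summits.Ventures.PercRepro.ExcessOneProjection

/-!
# Partner families under flips and projections

Bookkeeping for the `a`-edges of a family `M` (`partner a M`, the pairs `E, insert a E` of members):
* the `a`-edges of `F \\ F` are `diffsX a F ∩ diffsY a F` (`diffsX_inter_diffsY_eq_partner_diffs`);
* a flip along `M` (`flip M G = G.image (· ∆ M)`) preserves the number of `b`-edges for every `b`
  (`card_partner_flip`: for `b ∉ M` the flip commutes with `partner b`, and the flip along `{b}`
  fixes `partner b`);
* projections commute (`proj_proj_comm`), the difference family of a projection is the projection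
  of the difference family (`diffs_proj_eq_proj_diffs`), and without pure `{a, b}`-diagonals the
  `a`-edges of `proj b M` are the projections of the `a`-edges of `M`
  (`partner_proj_eq_proj_partner`).

These are the general identities behind Theorem (NT) of proofs/MINE1-theoremS.md Addendum 30
(ExcessOneNonTightening.lean).
-/

namespace PercRepro.MSTight

open Finset
open scoped FinsetFamily symmDiff

variable {α : Type*} [DecidableEq α]

/-- Membership in the partner family: `A ∈ F`, `r ∉ A` and `insert r A ∈ F`. -/
theorem mem_partner_iff {r : α} {F : Finset (Finset α)} {A : Finset α} :
    A ∈ partner r F ↔ A ∈ F ∧ r ∉ A ∧ insert r A ∈ F := by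
  simp only [partner, mem_inter, mem_part0, mem_partr]
  tauto

/-- The `r`-edges of the difference family are `diffsX r F ∩ diffsY r F`. -/
theorem diffsX_inter_diffsY_eq_partner_diffs (r : α) (F : Finset (Finset α)) :
    diffsX r F ∩ diffsY r F = partner r (F \\ F) := by
  ext E
  simp only [mem_inter, mem_diffsX_iff, mem_diffsY_iff, mem_partner_iff]
  tauto

/-- Partner members are members. -/
theorem mem_of_mem_partner {r : α} {F : Finset (Finset α)} {A : Finset α} (h : A ∈ partner r F) :
    A ∈ F := (mem_partner_iff.1 h).1

/-- The `r`-partner of a partner member is a member. -/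
theorem insert_mem_of_mem_partner {r : α} {F : Finset (Finset α)} {A : Finset α}
    (h : A ∈ partner r F) : insert r A ∈ F := (mem_partner_iff.1 h).2.2

/-- Differences of members of a subfamily are differences. -/
theorem diffs_mono_self {F G : Finset (Finset α)} (h : G ⊆ F) : G \\ G ⊆ F \\ F := by
  intro E hE
  obtain ⟨A, hA, B, hB, rfl⟩ := mem_diffs.1 hE
  exact mem_diffs.2 ⟨A, h hA, B, h hB, rfl⟩

/-! ### Flips, projections and partner families: general identities -/

section General

/-- Membership in a flip: `W ∈ flip M G ↔ W ∆ M ∈ G`. -/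
theorem mem_flip_iff {M : Finset α} {G : Finset (Finset α)} {W : Finset α} :
    W ∈ flip M G ↔ W ∆ M ∈ G := by
  rw [mem_flip]
  constructor
  · rintro ⟨A, hA, rfl⟩
    rwa [symmDiff_symmDiff_cancel_right]
  · intro h
    exact ⟨W ∆ M, h, symmDiff_symmDiff_cancel_right M W⟩

/-- A flip along a set avoiding `b` commutes with the `b`-partner family. -/
theorem partner_flip_of_notMem {M : Finset α} {b : α} (hb : b ∉ M) (G : Finset (Finset α)) :
    partner b (flip M G) = flip M (partner b G) := by
  ext E
  simp only [mem_partner_iff, mem_flip_iff]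
  have e : b ∉ E → insert b E ∆ M = insert b (E ∆ M) := by
    intro hbE
    ext x
    simp only [mem_symmDiff, mem_insert]
    by_cases hx : x = b
    · subst hx; simp [hb, hbE]
    · simp only [hx, false_or]
  constructor
  · rintro ⟨h1, hbE, h2⟩
    refine ⟨h1, by simp [mem_symmDiff, hbE, hb], ?_⟩
    rwa [e hbE] at h2
  · rintro ⟨h1, hbE, h2⟩
    have hbE' : b ∉ E := fun h => hbE (by simp [mem_symmDiff, h, hb])
    exact ⟨h1, hbE', by rwa [e hbE']⟩

/-- Flipping along `{b}` preserves the `b`-partner family. -/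
theorem partner_flip_singleton (b : α) (G : Finset (Finset α)) :
    partner b (flip {b} G) = partner b G := by
  ext E
  simp only [mem_partner_iff, mem_flip_iff]
  constructor
  · rintro ⟨h1, hbE, h2⟩
    have e1 : E ∆ {b} = insert b E := by
      ext x; simp only [mem_symmDiff, mem_insert, mem_singleton]
      by_cases hx : x = b
      · subst hx; simp [hbE]
      · simp [hx]
    have e2 : insert b E ∆ {b} = E := by
      ext x; simp only [mem_symmDiff, mem_insert, mem_singleton]
      by_cases hx : x = b
      · subst hx; simp [hbE]
      · simp [hx]
    rw [e1] at h1; rw [e2] at h2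
    exact ⟨h2, hbE, h1⟩
  · rintro ⟨h1, hbE, h2⟩
    have e1 : E ∆ {b} = insert b E := by
      ext x; simp only [mem_symmDiff, mem_insert, mem_singleton]
      by_cases hx : x = b
      · subst hx; simp [hbE]
      · simp [hx]
    have e2 : insert b E ∆ {b} = E := by
      ext x; simp only [mem_symmDiff, mem_insert, mem_singleton]
      by_cases hx : x = b
      · subst hx; simp [hbE]
      · simp [hx]
    rw [e1, e2]
    exact ⟨h2, hbE, h1⟩

/-- A flip along `M ∋ b` is the flip along `{b}` of the flip along `M.erase b`. -/
theorem flip_eq_flip_singleton_flip_erase {M : Finset α} {b : α} (hb : b ∈ M)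
    (G : Finset (Finset α)) : flip M G = flip {b} (flip (M.erase b) G) := by
  ext W
  simp only [mem_flip_iff]
  have e : W ∆ M = W ∆ {b} ∆ M.erase b := by
    rw [symmDiff_assoc]
    congr 1
    ext x
    simp only [mem_symmDiff, mem_singleton, mem_erase]
    by_cases hx : x = b
    · subst hx; simp [hb]
    · simp [hx]
  rw [e]

/-- Flipping preserves the number of `b`-edges. -/
theorem card_partner_flip (M : Finset α) (b : α) (G : Finset (Finset α)) :
    (partner b (flip M G)).card = (partner b G).card := by
  by_cases hb : b ∈ M
  · rw [flip_eq_flip_singleton_flip_erase hb, partner_flip_singleton,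
      partner_flip_of_notMem (notMem_erase b M), flip]
    exact card_image_of_injective _ (symmDiff_left_injective _)
  · rw [partner_flip_of_notMem hb, flip]
    exact card_image_of_injective _ (symmDiff_left_injective _)

end General

section Proj

/-- Projections commute. -/
theorem proj_proj_comm (a b : α) (F : Finset (Finset α)) :
    proj a (proj b F) = proj b (proj a F) := by
  simp only [proj, image_image]
  congr 1
  ext t
  simp [erase_right_comm]

/-- The difference family of a projection is the projection of the difference family. -/
theorem diffs_proj_eq_proj_diffs (b : α) (F : Finset (Finset α)) :
    proj b F \\ proj b F = proj b (F \\ F) := by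
  have e : ∀ G : Finset (Finset α), proj b G = G.image fun t => t \ {b} := by
    intro G
    simp only [proj, erase_eq]
  rw [e, e, diffs_image_sdiff]

/-- Without pure `{a, b}`-diagonals, the `a`-edges of the projection along `b` are the
projections of the `a`-edges. -/
theorem partner_proj_eq_proj_partner {M : Finset (Finset α)} {a b : α} (hab : a ≠ b)
    (h1 : ∀ E, a ∉ E → b ∉ E → E ∈ M → insert a (insert b E) ∈ M →
      insert a E ∈ M ∨ insert b E ∈ M)
    (h2 : ∀ E, a ∉ E → b ∉ E → insert a E ∈ M → insert b E ∈ M →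
      E ∈ M ∨ insert a (insert b E) ∈ M) :
    partner a (proj b M) = proj b (partner a M) := by
  ext E
  constructor
  · intro hE
    obtain ⟨hE1, haE, hE2⟩ := mem_partner_iff.1 hE
    obtain ⟨t, ht, hte⟩ := mem_proj.1 hE1
    obtain ⟨t', ht', ht'e⟩ := mem_proj.1 hE2
    have hbE : b ∉ E := by rw [← hte]; exact notMem_erase b t
    have haE' : a ∉ insert b E := by simp [haE, hab]
    -- the two lifts
    have hlift : E ∈ M ∨ insert b E ∈ M := by
      by_cases hbt : b ∈ t
      · right; rw [← hte, insert_erase hbt]; exact ht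
      · left; rw [← hte, erase_eq_of_notMem hbt]; exact ht
    have hlift' : insert a E ∈ M ∨ insert a (insert b E) ∈ M := by
      by_cases hbt : b ∈ t'
      · right; rw [insert_comm, ← ht'e, insert_erase hbt]; exact ht'
      · left; rw [← ht'e, erase_eq_of_notMem hbt]; exact ht'
    -- produce the partner member `E` or `insert b E`
    have kE : insert a E ∈ M → E ∈ M → E ∈ proj b (partner a M) := fun h h' =>
      mem_proj.2 ⟨E, mem_partner_iff.2 ⟨h', haE, h⟩, erase_eq_of_notMem hbE⟩
    have kbE : insert a (insert b E) ∈ M → insert b E ∈ M → E ∈ proj b (partner a M) :=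
      fun h h' => mem_proj.2 ⟨insert b E, mem_partner_iff.2 ⟨h', haE', h⟩, erase_insert hbE⟩
    rcases hlift with hEM | hbEM <;> rcases hlift' with haEM | habEM
    · exact kE haEM hEM
    · rcases h1 E haE hbE hEM habEM with h | h
      · exact kE h hEM
      · exact kbE habEM h
    · rcases h2 E haE hbE haEM hbEM with h | h
      · exact kE haEM h
      · exact kbE h hbEM
    · exact kbE habEM hbEM
  · intro hE
    obtain ⟨k, hk, rfl⟩ := mem_proj.1 hE
    obtain ⟨hk1, hak, hk2⟩ := mem_partner_iff.1 hk
    refine mem_partner_iff.2 ⟨mem_proj.2 ⟨k, hk1, rfl⟩, by simp [hak], ?_⟩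
    refine mem_proj.2 ⟨insert a k, hk2, ?_⟩
    rw [erase_insert_of_ne hab]

end Proj


end PercRepro.MSTight
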